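import Mathlib
import Summits.NavierStokesRegularity.NavierStokesRegularity.Theorems.EulerZoomLiouvillePowerGaugeEulerLiouvilleNeedleStrainClockMember
import Summits.NavierStokesRegularity.NavierStokesRegularity.Theorems.EulerZoomLiouvillePowerGaugeEulerLiouvilleNeedleStrainClockEnstrophy
import Summits.NavierStokesRegularity.NavierStokesRegularity.Theorems.EulerZoomLiouvillePowerGaugeEulerLiouvilleNeedleClockPast
import HarnessLib.Audit

/-!
# Crux E `EulerZoomLiouville.PowerGaugeEulerLiouville` — SUBCRITICAL STRAIN CLOCKS FOR PAST-EXACT MEMBERS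
# (plate t40d of ROUND-40, shifted twins): a member exactly self-similar about `(T, x₀)` on a past sub-slab whose `C²`
# profile has subcritical stretching (with a sub-power vorticity envelope, or below the Liouville rate) is trivial

Route №10 `EulerZoomLiouville` (NavierStokesRegularity), crux E = stmt-NavierStokesRegularity-19832, line `birth`,
registered residues `stub_selfSimilarC2Needle` / past disjunct `IsPastSelfSimilarClassical` (LEAD ns-typeII-p2 g12, skeleton
v70, alternative 6 `… ∧ ContDiff ℝ 2 V ∧ HasResidenceClock ρ V`); seat ns-ezl-w5 g3, `--supports stmt-NavierStokesRegularity-19832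
--as helper`.  By-name composition of this seat's PROFILE-LEVEL strain clocks (`NeedleClock.powerClock_of_subcriticalStrain`,
…NeedleStrainClockMember p648071; `NeedleClock.powerClock_of_stretching_lt`, …NeedleStrainClockEnstrophy p648172) with ns-ezl-w4 g4's
PAST residence-clock kill (`NeedleRace.selfSimilar_ae_eq_zero_of_subcriticalClockC2_past`, …NeedleClockPast p648147) and its past
budgets (`NeedleRace.needleBudgets_of_selfSimilarC2_past`); binder prefix VERBATIM from p645615's
`Past.selfSimilar_ae_eq_zero_of_vorticalFastChannelC2_profile_free_past`:

* **`NeedleRace.selfSimilar_ae_eq_zero_of_strainClockC2_past`** — past-exact about `(T, x₀)` for `τ < T₁ ≤ min 0 T`, `V ∈ C²`,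
  stretching `⟪DV(z) v, v⟫ ≤ s‖v‖²` (`s < 1`, all `z, v`) and `log ‖curl V z‖ = o(‖z‖^{2+ρ})` ⇒ `u = 0` a.e.;
* **`NeedleRace.selfSimilar_ae_eq_zero_of_strongStrainClockC2_past`** — the same with `s < (1+2ρ)/(2(2+ρ))` and NO envelope
  (the past `E`-budget `∫_{B̄_L}‖DV‖² ≤ c_E L^{1−ρ}` runs the Liouville–Chebyshev race).

NOT NS, not E: conditional strata of the crux CLASS (MODEL lattice) for past-exact members; 19832 OPEN.  References:
Constantin–Ignatova–Vicol arXiv:2602.17570 §3.4–§3.5 [ConstantinIgnatovaVicol2026Putative]; Grönwall, Liouville [folklore].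
-/

noncomputable section

-- the summit and its single problem share the name `NavierStokesRegularity` (D-0017 nested layout)
set_option linter.dupNamespace false

open Set Filter Topology Metric Function MeasureTheory InnerProductSpace
open scoped RealInnerProductSpace NNReal ENNReal

namespace Summit.NavierStokesRegularity.NavierStokesRegularity.Theorems.PowerGaugeEulerLiouville.NeedleRace

open Literature.Analysis Literature.Analysis.FluidPDE
open Summit.NavierStokesRegularity.NavierStokesRegularity.Theorems.PowerGaugeEulerLiouville

variable {ρ T T₁ : ℝ} {V : EuclideanSpace ℝ (Fin 3) → EuclideanSpace ℝ (Fin 3)}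
  {u : ℝ → EuclideanSpace ℝ (Fin 3) → EuclideanSpace ℝ (Fin 3)} {p : ℝ → EuclideanSpace ℝ (Fin 3) → ℝ}
  {H : ℝ → EuclideanSpace ℝ (Fin 3) → EuclideanSpace ℝ (Fin 3) →L[ℝ] EuclideanSpace ℝ (Fin 3)} {c : ℝ≥0}
  {P : EuclideanSpace ℝ (Fin 3) → ℝ}

/-- **SUBCRITICAL STRAIN CLOCK, PAST-EXACT MEMBER (t40d (S5) shifted twin).**  A member of the window class
(`0 < ρ ≤ ½`, crux hypotheses verbatim) exactly self-similar about `(T, x₀)` for `τ < T₁` (`T₁ ≤ 0`, `T₁ ≤ T`) with a `C²`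
velocity profile whose stretching rate is subcritical (`⟪DV(z) v, v⟫ ≤ s‖v‖²`, `s < 1`) and whose vorticity has a sub-power
envelope (`log ‖curl V z‖ ≤ ε‖z‖^{2+ρ}` beyond some radius, every `ε > 0`) is trivial.
[cite: ConstantinIgnatovaVicol2026Putative, §3.5] -/
theorem selfSimilar_ae_eq_zero_of_strainClockC2_past (hρ : 0 < ρ) (hρh : ρ ≤ 1 / 2) (hT₁ : T₁ ≤ 0)
    (hTT₁ : T₁ ≤ T) (x₀ : EuclideanSpace ℝ (Fin 3))
    (hsw : IsSuitableWeakSolutionOn (slab (EuclideanSpace ℝ (Fin 3)) (Iio 0) isOpen_Iio) 0 0 u p)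
    (hH : HasWeakSpatialGradientOn (slab (EuclideanSpace ℝ (Fin 3)) (Iio 0) isOpen_Iio) u H)
    (hgauge : ∀ a : ℝ, 0 < a →
      ENNReal.ofReal (a ^ (2 * ρ)) * cknA a (0 : ℝ × EuclideanSpace ℝ (Fin 3)) u +
          ENNReal.ofReal (a ^ ρ) * cknE a (0 : ℝ × EuclideanSpace ℝ (Fin 3)) H +
        ENNReal.ofReal (a ^ (2 * ρ)) * cknD a (0 : ℝ × EuclideanSpace ℝ (Fin 3)) p ≤ (c : ℝ≥0∞))
    (hu : ∀ τ : ℝ, τ < T₁ → u τ = fun x => selfSimilarCollapse (1 / (2 + ρ)) T V τ (x - x₀))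
    (hp : ∀ τ : ℝ, τ < T₁ → p τ = fun x => selfSimilarCollapsePressure (1 / (2 + ρ)) T P τ (x - x₀))
    (hV : ContDiff ℝ 2 V) {s : ℝ} (hs1 : s < 1)
    (hstrain : ∀ z v : EuclideanSpace ℝ (Fin 3), ⟪fderiv ℝ V z v, v⟫ ≤ s * ‖v‖ ^ 2)
    (henv : ∀ ε : ℝ, 0 < ε → ∃ R₂ : ℝ, ∀ z : EuclideanSpace ℝ (Fin 3), R₂ ≤ ‖z‖ →
      Real.log ‖curl V z‖ ≤ ε * ‖z‖ ^ (2 + ρ)) :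
    uncurry u =ᵐ[volume.restrict (Iio (0 : ℝ) ×ˢ (univ : Set (EuclideanSpace ℝ (Fin 3))))] 0 := by
  obtain ⟨P', hprof⟩ := Past.exists_isSelfSimilarEulerProfile hρ hT₁ hTT₁ hsw.distributional hu hp hV
  exact selfSimilar_ae_eq_zero_of_subcriticalClockC2_past hρ hρh hT₁ hTT₁ x₀ hsw hH hgauge hu hp hV
    (NeedleClock.powerClock_of_subcriticalStrain hprof (by linarith) hs1 hstrain henv)

/-- **ENVELOPE-FREE STRAIN CLOCK, PAST-EXACT MEMBER (t40d M2 shifted twin).**  A member of the window class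
(`0 < ρ ≤ ½`, crux hypotheses verbatim) exactly self-similar about `(T, x₀)` for `τ < T₁` (`T₁ ≤ 0`, `T₁ ≤ T`) with a `C²`
velocity profile whose stretching rate satisfies `⟪DV(z) v, v⟫ ≤ s‖v‖²` for all `z, v` with `s < (1+2ρ)/(2(2+ρ))` is
trivial (the past `E`-budget runs the Liouville–Chebyshev race). [cite: ConstantinIgnatovaVicol2026Putative, §3.5] -/
theorem selfSimilar_ae_eq_zero_of_strongStrainClockC2_past (hρ : 0 < ρ) (hρh : ρ ≤ 1 / 2) (hT₁ : T₁ ≤ 0)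
    (hTT₁ : T₁ ≤ T) (x₀ : EuclideanSpace ℝ (Fin 3))
    (hsw : IsSuitableWeakSolutionOn (slab (EuclideanSpace ℝ (Fin 3)) (Iio 0) isOpen_Iio) 0 0 u p)
    (hH : HasWeakSpatialGradientOn (slab (EuclideanSpace ℝ (Fin 3)) (Iio 0) isOpen_Iio) u H)
    (hgauge : ∀ a : ℝ, 0 < a →
      ENNReal.ofReal (a ^ (2 * ρ)) * cknA a (0 : ℝ × EuclideanSpace ℝ (Fin 3)) u +
          ENNReal.ofReal (a ^ ρ) * cknE a (0 : ℝ × EuclideanSpace ℝ (Fin 3)) H +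
        ENNReal.ofReal (a ^ (2 * ρ)) * cknD a (0 : ℝ × EuclideanSpace ℝ (Fin 3)) p ≤ (c : ℝ≥0∞))
    (hu : ∀ τ : ℝ, τ < T₁ → u τ = fun x => selfSimilarCollapse (1 / (2 + ρ)) T V τ (x - x₀))
    (hp : ∀ τ : ℝ, τ < T₁ → p τ = fun x => selfSimilarCollapsePressure (1 / (2 + ρ)) T P τ (x - x₀))
    (hV : ContDiff ℝ 2 V) {s : ℝ} (hs : s < (1 + 2 * ρ) / (2 * (2 + ρ)))
    (hstrain : ∀ z v : EuclideanSpace ℝ (Fin 3), ⟪fderiv ℝ V z v, v⟫ ≤ s * ‖v‖ ^ 2) :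
    uncurry u =ᵐ[volume.restrict (Iio (0 : ℝ) ×ˢ (univ : Set (EuclideanSpace ℝ (Fin 3))))] 0 := by
  have h2ρ : (0 : ℝ) < 2 + ρ := by linarith
  obtain ⟨P', hprof⟩ := Past.exists_isSelfSimilarEulerProfile hρ hT₁ hTT₁ hsw.distributional hu hp hV
  -- the class budgets of the profile, from the far past
  have hA : ∀ a : ℝ, 0 < a → ENNReal.ofReal (a ^ (2 * ρ)) *
      cknA a (0 : ℝ × EuclideanSpace ℝ (Fin 3)) u ≤ (c : ℝ≥0∞) :=
    fun a ha => le_trans (le_trans le_self_add le_self_add) (hgauge a ha)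
  have hE : ∀ a : ℝ, 0 < a → ENNReal.ofReal (a ^ ρ) *
      cknE a (0 : ℝ × EuclideanSpace ℝ (Fin 3)) H ≤ (c : ℝ≥0∞) :=
    fun a ha => le_trans (le_trans le_add_self le_self_add) (hgauge a ha)
  obtain ⟨-, cA, cE, -, hcE, -, hbE⟩ :=
    needleBudgets_of_selfSimilarC2_past hρ hρh hT₁ hTT₁ x₀ hsw.distributional hH hA hE hu hp hV
  -- the race condition `3/(2+ρ) < 2(1−s)`
  have hrace : 3 / (2 + ρ) < 2 * (1 - s) := by
    have h1 : s * (2 * (2 + ρ)) < 1 + 2 * ρ := (lt_div_iff₀ (by positivity)).1 hs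
    rw [div_lt_iff₀ h2ρ]
    nlinarith
  exact selfSimilar_ae_eq_zero_of_subcriticalClockC2_past hρ hρh hT₁ hTT₁ x₀ hsw hH hgauge hu hp hV
    (NeedleClock.powerClock_of_stretching_lt hprof hρ.le hrace hstrain hcE hbE)

end Summit.NavierStokesRegularity.NavierStokesRegularity.Theorems.PowerGaugeEulerLiouville.NeedleRace

end
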